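import Literature.MathematicalPhysics.QuantumFieldTheory.Balaban1983to89.B12Spaces329NearSharp

/-!
# `Balaban1983to89.B12Spaces329NearStep` — T. Bałaban, *Renormalization group approach to lattice gauge field theories. I*,
Commun. Math. Phys. **109** (1987) 249–301 [Balaban1987RG1]: the near-`G` clause of (3.29) p. 276 for the concrete (i)–(iii) (sharp
constants, `B12Spaces329NearSharp`) RE-STATED WITH THE `𝔤ᶜ`-CLOSURE HYPOTHESIS AT THE STEP'S `ξ` ONLY — the form satisfiable by print's
SEMISIMPLE groups (`𝔤ᶜ = 𝔰𝔩(N, ℂ)`; sibling `B12RegularSpaces111SpecialUnitary`), PROVED without re-running the budget: the norm clauses of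
(ii) do not see `𝔤ᶜ` and are imported from `condII_near_sharp` over the `𝔤ᶜ`-blind model `⟨G, Gᶜ, ⊤⟩`

HONEST FRAMING (cell `lit-balaban`, verbatim): statement-level skeleton of published theorems with citation tags; proofs where landed; nothing here is a claim about the Yang–Mills mass gap.

PDF held: `paper:balaban1987-cmp109-rg-i-small-field` (journal page = PDF page + 248); pp. 251–252, 262, 276 read from the text layer.

WHY THIS FILE (an erratum to this lineage's OWN hypothesis list; nothing printed is affected).  The near-`G` theorems of
`B12Spaces329Near` (p07 gen 4: `condII_near`, `satisfiesI_III_act_near`) and `B12Spaces329NearSharp` (gen 5: `condII_near_sharp`,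
`satisfiesI_III_act_near_sharp`, `exists_neighbourhood`) carry the model hypothesis
`hgcN : ∀ (ξ : ℝ) (X ∈ 𝔤ᶜ) (Y ∈ 𝔤ᶜ), ξ(‖X‖ + ‖Y‖) ≤ 1/4 → newPot ξ X Y ∈ 𝔤ᶜ` («`𝔤ᶜ` is closed under the BCH composition near `0`»)
quantified over ALL real `ξ`, although the proofs use it only at the step's `ξ = c.ξ > 0`.  For `𝔤ᶜ = M_N(ℂ)` (the `U(N)`-type model,
`B12RegularSpaces111Unitary`) this is harmless, but for print's semisimple groups (p. 251 «We assume that G is semisimple», e.g. `G = SU(N)`,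
`𝔤ᶜ = 𝔰𝔩(N, ℂ)`) the `∀ ξ` form is NOT satisfiable in general: for `ξ < 0` the smallness premise is void, and e.g. in `𝔰𝔩(8, ℂ)` an `X` with
`exp(iξX) = e^{iπ/4}·1` gives `newPot ξ X 0 = (iξ)⁻¹log(e^{iπ/4}·1) = (π/4ξ)·1`, of trace `2π/ξ ≠ 0` (the logarithmic series converges since
`|e^{iπ/4} − 1| < 1`).  This file therefore proves the same three theorems under the WEAKER, satisfiable hypothesis
`hgcN : ∀ X ∈ 𝔤ᶜ, ∀ Y ∈ 𝔤ᶜ, c.ξ(‖X‖ + ‖Y‖) ≤ 1/4 → newPot c.ξ X Y ∈ 𝔤ᶜ` (closure at the one `ξ` of the step; for `𝔰𝔩(N, ℂ)` and `ξ > 0`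
it holds by `det e^Z = e^{tr Z}`, see the sibling).  MECHANISM: conditions (i), (iii) and the two norm clauses of (ii) do not mention `𝔤ᶜ`, so
they are read off `B12Spaces329NearSharp.condII_near_sharp` applied to the `𝔤ᶜ`-BLIND model `⟨𝓜.G, 𝓜.Gᶜ, ⊤⟩` (for which every
`𝔤ᶜ`-hypothesis is trivial); only the clause «A‴ has values in 𝔤ᶜ» is re-proved, from the weak hypothesis, `Ad(G)`-stability and the two
BCH ranges `norm_newPot2_le_sharp`/`norm_newPot3_le_sharp`.  The assembly and the `∃δ` form repeat the sibling's short arguments.  No `Prop`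
placeholder, no definition, no new fact; axioms standard.  Unit `lit-balaban-p07` (Phase-2 seat p07 gen 5; TAKING line HOME/STATUS.md
2026-08-21T06:52:00Z), HOME `run/shared/lean/pub/lit-balaban/`.

THE PRINT, verbatim (p. 276): *«The functions (3.25), (3.26) are gauge invariant with respect to the simultaneous gauge transformations
𝐔 → 𝐔^u, 𝐉 → R(u)𝐉, B → R(u)B, (3.29)  for Gᶜ-valued transformations u in a sufficiently small neighborhood of G-valued transformations, so
that the configurations after the transformations belong to proper spaces also.»*  pp. 251–252: *«We assume that G is semisimple and that it
is a Lie subgroup of a group of complex unitary matrices, for example G ⊂ U(N). … the complexified group Gᶜ. Elements of this group are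
defined as matrices of the form 𝐔 = U′U, where U ∈ G and U′ = exp iA′, A′ ∈ 𝔤ᶜ, 𝔤ᶜ is the complexification of the real Lie algebra 𝔤.»*
-/

namespace Literature.MathematicalPhysics.QuantumFieldTheory.Balaban1983to89.B12Spaces329NearStep

open NormedSpace
open Literature.MathematicalPhysics.QuantumFieldTheory.Balaban1983to89
open Literature.MathematicalPhysics.QuantumFieldTheory.Balaban1983to89.B12RegularSpaces111
open Literature.MathematicalPhysics.QuantumFieldTheory.Balaban1983to89.B12RegularSpaces111Gauge
open Literature.MathematicalPhysics.QuantumFieldTheory.Balaban1983to89.B12RegularSpaces111Mono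
open Literature.MathematicalPhysics.QuantumFieldTheory.Balaban1983to89.B12Membership314
open Literature.MathematicalPhysics.QuantumFieldTheory.Balaban1983to89.B12Membership313II
open Literature.MathematicalPhysics.QuantumFieldTheory.Balaban1983to89.B12Spaces329NearBond
open Literature.MathematicalPhysics.QuantumFieldTheory.Balaban1983to89.B12Spaces329Near
open Literature.MathematicalPhysics.QuantumFieldTheory.Balaban1983to89.B12Spaces329NearSharp
open Complex (I)

noncomputable section

variable {P : Params} {i : ℕ} {𝔸 : Type*} [NormedRing 𝔸] [NormedAlgebra ℂ 𝔸] [CompleteSpace 𝔸]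
variable {𝓜 : Model 𝔸}

/-! ## §1. The `𝔤ᶜ`-blind model `⟨G, Gᶜ, ⊤⟩`: conditions (i) and the norm clauses of (ii) do not see `𝔤ᶜ` -/

/-- Condition (i) only mentions `G`: it transfers to the `𝔤ᶜ`-blind model `⟨𝓜.G, 𝓜.Gᶜ, ⊤⟩`. [cite: Balaban1987RG1, (1.11)-(1.12) p.262] -/
theorem condI_blind {F : Frame P i 𝔸} {c : StepConsts} {α₀ : ℝ} {U : PBond P i → 𝔸ˣ} (h : CondI 𝓜 F c α₀ U) :
    CondI (⟨𝓜.G, 𝓜.Gc, ⊤⟩ : Model 𝔸) F c α₀ U :=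
  ⟨h.gValued, h.plaq_lt, h.localGauge⟩

omit [CompleteSpace 𝔸] in
/-- Condition (ii) transfers to the `𝔤ᶜ`-blind model (its clause «A′ has values in 𝔤ᶜ» becomes vacuous). [cite: Balaban1987RG1, (1.13) p.262] -/
theorem condII_blind {X : Region P i} {c : StepConsts} {α₁ : ℝ} {U : PBond P i → 𝔸ˣ} {A' : PBond P i → 𝔸}
    (h : CondII 𝓜 X c α₁ U A') : CondII (⟨𝓜.G, 𝓜.Gc, ⊤⟩ : Model 𝔸) X c α₁ U A' :=
  ⟨fun _ _ => Submodule.mem_top, h.norm_lt, h.nabla_lt⟩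

/-! ## §2. Condition (ii) for the new pair, closure hypothesis at the step's `ξ` only -/

/-- **(ii) for the new pair `(U^w, R(w)A″)`, sharp constants, `𝔤ᶜ`-closure AT THE STEP'S `ξ`.**  As
`B12Spaces329NearSharp.condII_near_sharp` (frame region = the whole lattice; `|E| ≤ δ₀`, `|∇^ξ_{U,μ}E| ≤ δ₁`, `ξ(α₁ + 2δ₀) ≤ 1/16`,
`α₁′ ≥ α₁ + 3(δ₀ + δ₁ + ξα₀δ₀)`), but the closure of `𝔤ᶜ` under `newPot` is asked only at `ξ = c.ξ`:
`∀ X ∈ 𝔤ᶜ, ∀ Y ∈ 𝔤ᶜ, c.ξ(‖X‖ + ‖Y‖) ≤ 1/4 → newPot c.ξ X Y ∈ 𝔤ᶜ`.  The two norm clauses are those of `condII_near_sharp` over the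
`𝔤ᶜ`-blind model; «A‴ ∈ 𝔤ᶜ» from `E ∈ 𝔤ᶜ`, `A′ ∈ 𝔤ᶜ`, `Ad(G)𝔤ᶜ ⊆ 𝔤ᶜ` and the two BCH compositions, which are in range
(`norm_newPot2_le_sharp`, `norm_newPot3_le_sharp`). [cite: Balaban1987RG1, (3.29) p.276] -/
theorem condII_near_step (hG1 : ∀ g ∈ 𝓜.G, ‖(g : 𝔸)‖ ≤ 1) (hgc : ∀ g ∈ 𝓜.G, ∀ X ∈ 𝓜.gc, (g : 𝔸) * X * ↑g⁻¹ ∈ 𝓜.gc)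
    {c : StepConsts} (hgcN : ∀ X ∈ 𝓜.gc, ∀ Y ∈ 𝓜.gc, c.ξ * (‖X‖ + ‖Y‖) ≤ 1 / 4 → newPot c.ξ X Y ∈ 𝓜.gc)
    {F : Frame P i 𝔸} (hXb : ∀ b, b ∈ F.X.bonds) (hXp : ∀ p, p ∈ F.X.plaqs) (hξ : 0 < c.ξ)
    {α₀ α₁ δ₀ δ₁ α₁' : ℝ} (hα₀ : 0 ≤ α₀) (hα₁ : 0 ≤ α₁) (hδ₀ : 0 ≤ δ₀) (hδ₁ : 0 ≤ δ₁) (hs : c.ξ * (α₁ + 2 * δ₀) ≤ 1 / 16)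
    (hα₁' : α₁ + 3 * (δ₀ + δ₁ + c.ξ * α₀ * δ₀) ≤ α₁')
    {U : PBond P i → 𝔸ˣ} {A' : PBond P i → 𝔸} (hI : CondI 𝓜 F c α₀ U) (hII : CondII 𝓜 F.X c α₁ U A')
    {w : Site P i → 𝔸ˣ} (hw : ∀ x, w x ∈ 𝓜.G) {E : Site P i → 𝔸} (hEgc : ∀ x, E x ∈ 𝓜.gc) (hE0 : ∀ x, ‖E x‖ ≤ δ₀)
    (hE1 : ∀ x μ, ‖nabla c.ξ U μ E x‖ ≤ δ₁) :
    CondII 𝓜 F.X c α₁' (gaugeU w U)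
      (adJ w fun b => newPot c.ξ (E b.src) (newPot c.ξ (A' b) ((U b : 𝔸) * (-E b.tgt) * ↑(U b)⁻¹))) := by
  -- the norm clauses, from the sharp theorem over the `𝔤ᶜ`-blind model
  have h := condII_near_sharp (𝓜 := (⟨𝓜.G, 𝓜.Gc, ⊤⟩ : Model 𝔸)) hG1 (fun _ _ _ _ => Submodule.mem_top)
    (fun _ _ _ _ _ _ => Submodule.mem_top) hXb hXp hξ hα₀ hα₁ hδ₀ hδ₁ hs hα₁' (condI_blind hI) (condII_blind hII) hw
    (fun _ => Submodule.mem_top) hE0 hE1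
  refine ⟨fun b _ => ?_, h.norm_lt, h.nabla_lt⟩
  -- «A‴ has values in the algebra 𝔤ᶜ», under the weak closure hypothesis
  have hUG : U b ∈ 𝓜.G := hI.gValued b (hXb b)
  have hA : ‖A' b‖ ≤ α₁ := (hII.norm_lt b (hXb b)).le
  obtain ⟨h1, -, -⟩ := norm_newPot2_le_sharp hG1 hξ hα₁ hδ₀ hs hUG (hE0 b.tgt) hA
  obtain ⟨h2, -, -⟩ := norm_newPot3_le_sharp hG1 hξ hα₁ hδ₀ hs hUG (hE0 b.src) (hE0 b.tgt) hA
  show (w b.src : 𝔸) * newPot c.ξ (E b.src) (newPot c.ξ (A' b) ((U b : 𝔸) * (-E b.tgt) * ↑(U b)⁻¹)) * ↑(w b.src)⁻¹ ∈ 𝓜.gc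
  refine hgc _ (hw _) _ (hgcN _ (hEgc _) _ (hgcN _ (hII.gcValued b (hXb b)) _ ?_ (h1.trans (by norm_num))) (h2.trans (by norm_num)))
  exact hgc _ hUG _ (𝓜.gc.neg_mem (hEgc _))

/-! ## §3. Assembly and the `∃δ` form, closure hypothesis at the step's `ξ` only -/

/-- **The «proper spaces» clause of (3.29) for (i)–(iii), sharp constants, `𝔤ᶜ`-closure at the step's `ξ`.**  As
`B12Spaces329NearSharp.satisfiesI_III_act_near_sharp` — `(𝐔, 𝐉)` satisfying (i)–(iii) with `(α₀, α₁, γ₀)` on the whole lattice,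
`v = w·exp(iξE)`, `w` `G`-valued, `E(x) ∈ 𝔤ᶜ`, `exp iξE(x) ∈ Gᶜ`, `|E| ≤ δ₀`, `|∇^ξ_𝐔E| ≤ δ₁`, `ξ(α₁ + 2δ₀) ≤ 1/16` ⟹ `(𝐔, 𝐉)^v`
satisfies (i)–(iii) with any `α₀′ ≥ e^{2ξδ₀}α₀`, `γ₀′ ≥ e^{2ξδ₀}γ₀`, `α₁′ ≥ α₁ + (3 + 12α₁ + 3ξα₀)δ₀ + 4δ₁` — with the closure of `𝔤ᶜ` under
`newPot` asked only at `ξ = c.ξ` (satisfiable for `𝔤ᶜ = 𝔰𝔩(N, ℂ)`). [cite: Balaban1987RG1, (3.29) p.276] -/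
theorem satisfiesI_III_act_near_step (hG1 : ∀ g ∈ 𝓜.G, ‖(g : 𝔸)‖ ≤ 1) (hGc : 𝓜.G ≤ 𝓜.Gc)
    (hgc : ∀ g ∈ 𝓜.G, ∀ X ∈ 𝓜.gc, (g : 𝔸) * X * ↑g⁻¹ ∈ 𝓜.gc) {c : StepConsts}
    (hgcN : ∀ X ∈ 𝓜.gc, ∀ Y ∈ 𝓜.gc, c.ξ * (‖X‖ + ‖Y‖) ≤ 1 / 4 → newPot c.ξ X Y ∈ 𝓜.gc)
    {F : Frame P i 𝔸} (hXb : ∀ b, b ∈ F.X.bonds) (hXp : ∀ p, p ∈ F.X.plaqs) (hξ : 0 < c.ξ) (hcB : 0 ≤ c.cB)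
    {α₀ α₁ γ₀ δ₀ δ₁ α₀' α₁' γ₀' : ℝ} (hα₀ : 0 ≤ α₀) (hα₁ : 0 ≤ α₁) (hδ₁ : 0 ≤ δ₁) (hs : c.ξ * (α₁ + 2 * δ₀) ≤ 1 / 16)
    (hα₀' : Real.exp (2 * (c.ξ * δ₀)) * α₀ ≤ α₀') (hγ₀' : Real.exp (2 * (c.ξ * δ₀)) * γ₀ ≤ γ₀')
    (hα₁' : α₁ + (3 + 12 * α₁ + 3 * c.ξ * α₀) * δ₀ + 4 * δ₁ ≤ α₁')
    {Φ : FieldPair P i 𝔸ˣ 𝔸} (h : SatisfiesI_III 𝓜 F c α₀ α₁ γ₀ Φ)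
    {w : Site P i → 𝔸ˣ} (hw : ∀ x, w x ∈ 𝓜.G) {E : Site P i → 𝔸} (hEgc : ∀ x, E x ∈ 𝓜.gc)
    (heGc : ∀ x, expI c.ξ (E x) ∈ 𝓜.Gc) (hgcE : ∀ x, ∀ X ∈ 𝓜.gc, (expI c.ξ (E x) : 𝔸) * X * ↑(expI c.ξ (E x))⁻¹ ∈ 𝓜.gc)
    (hE0 : ∀ x, ‖E x‖ ≤ δ₀) (hE1 : ∀ x μ, ‖nabla c.ξ Φ.U μ E x‖ ≤ δ₁) :
    SatisfiesI_III 𝓜 F c α₀' α₁' γ₀' (act (w * fun x => expI c.ξ (E x)) Φ) := by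
  obtain ⟨hUGc, hJgc, U, A', hf, h1, h2, h3⟩ := h
  have hδ₀ : 0 ≤ δ₀ := (norm_nonneg _).trans (hE0 default)
  have hUG : ∀ b, U b ∈ 𝓜.G := fun b => h1.gValued b (hXb b)
  have hA : ∀ b, ‖A' b‖ ≤ α₁ := fun b => (h2.norm_lt b (hXb b)).le
  -- the covariant derivative of `E` in the `G`-valued factor
  set δ₁' := (1 + 4 * c.ξ * α₁) * δ₁ + 4 * α₁ * δ₀ with hδ₁'
  have hδ₁'0 : 0 ≤ δ₁' := by positivity
  have hξα : c.ξ * α₁ ≤ 1 / 8 := by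
    have : c.ξ * α₁ ≤ c.ξ * (α₁ + 2 * δ₀) := mul_le_mul_of_nonneg_left (by linarith) hξ.le
    linarith
  have hC : 0 ≤ 1 + 4 * c.ξ * α₁ := by positivity
  have hE1' : ∀ x μ, ‖nabla c.ξ U μ E x‖ ≤ δ₁' := fun x μ => by
    have h := norm_nabla_factor_le (E₁ := E (x.shift μ)) hξ hξα (hf ⟨x, μ⟩) (hA ⟨x, μ⟩) (hE0 x)
    have h' : ‖(c.ξ : ℂ)⁻¹ • ((Φ.U ⟨x, μ⟩ : 𝔸) * E (x.shift μ) * ↑(Φ.U ⟨x, μ⟩)⁻¹ - E x)‖ ≤ δ₁ := hE1 x μ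
    exact h.trans (by rw [hδ₁']; nlinarith [mul_le_mul_of_nonneg_left h' hC])
  have hα₀le : α₀ ≤ α₀' := by
    have : (1 : ℝ) * α₀ ≤ Real.exp (2 * (c.ξ * δ₀)) * α₀ :=
      mul_le_mul_of_nonneg_right (Real.one_le_exp (by positivity)) hα₀
    linarith
  have hα₁'' : α₁ + 3 * (δ₀ + δ₁' + c.ξ * α₀ * δ₀) ≤ α₁' := by
    have hξα16 : c.ξ * α₁ ≤ 1 / 16 := by nlinarith [mul_nonneg hξ.le hδ₀]
    have h4 : 3 * ((1 + 4 * c.ξ * α₁) * δ₁) ≤ 4 * δ₁ := by nlinarith [mul_le_mul_of_nonneg_right hξα16 hδ₁]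
    have h5 : 3 * (4 * α₁ * δ₀) = 12 * α₁ * δ₀ := by ring
    rw [hδ₁']
    nlinarith
  refine ⟨?_, ?_, gaugeU w U,
    adJ w fun b => newPot c.ξ (E b.src) (newPot c.ξ (A' b) ((U b : 𝔸) * (-E b.tgt) * ↑(U b)⁻¹)), ?_, ?_, ?_, ?_⟩
  · intro b _
    have hv : ∀ x, (w * fun x => expI c.ξ (E x)) x ∈ 𝓜.Gc := fun x => 𝓜.Gc.mul_mem (hGc (hw x)) (heGc x)
    exact 𝓜.Gc.mul_mem (𝓜.Gc.mul_mem (hv _) (hUGc b (hXb b))) (𝓜.Gc.inv_mem (hv _))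
  · intro b _
    have e : (act (w * fun x => expI c.ξ (E x)) Φ).J = adJ w (adJ (fun x => expI c.ξ (E x)) Φ.J) := adJ_mul _ _ _
    rw [e]
    exact hgc _ (hw _) _ (hgcE _ _ (hJgc b (hXb b)))
  · exact factors_near hG1 hξ hα₁ hδ₀ hs hf hUG hA w hE0
  · exact condI_mono hcB hα₀le (condI_gaugeU hG1 hw h1)
  · exact condII_near_step hG1 hgc hgcN hXb hXp hξ hα₀ hα₁ hδ₀ hδ₁'0 hs hα₁'' h1 h2 hw hEgc hE0 hE1'
  · exact condIII_near hG1 hξ.le hα₀ hα₀' hγ₀' hw hE0 h3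

/-- **«A sufficiently small neighborhood of G-valued transformations», `∃δ` form, `𝔤ᶜ`-closure at the step's `ξ`.**  As
`B12Spaces329NearSharp.exists_neighbourhood`: for all `α₀′ > α₀`, `α₁′ > α₁`, `γ₀′ > γ₀` (and `ξα₁ < 1/16`) there is `δ > 0` such that
`|E| ≤ δ`, `|∇^ξ_𝐔E| ≤ δ` suffice. [cite: Balaban1987RG1, (3.29) p.276] -/
theorem exists_neighbourhood_step (hG1 : ∀ g ∈ 𝓜.G, ‖(g : 𝔸)‖ ≤ 1) (hGc : 𝓜.G ≤ 𝓜.Gc)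
    (hgc : ∀ g ∈ 𝓜.G, ∀ X ∈ 𝓜.gc, (g : 𝔸) * X * ↑g⁻¹ ∈ 𝓜.gc) {c : StepConsts}
    (hgcN : ∀ X ∈ 𝓜.gc, ∀ Y ∈ 𝓜.gc, c.ξ * (‖X‖ + ‖Y‖) ≤ 1 / 4 → newPot c.ξ X Y ∈ 𝓜.gc)
    {F : Frame P i 𝔸} (hXb : ∀ b, b ∈ F.X.bonds) (hXp : ∀ p, p ∈ F.X.plaqs) (hξ : 0 < c.ξ) (hcB : 0 ≤ c.cB)
    {α₀ α₁ γ₀ α₀' α₁' γ₀' : ℝ} (hα₀ : 0 ≤ α₀) (hα₁ : 0 ≤ α₁) (hγ₀ : 0 ≤ γ₀) (hξα : c.ξ * α₁ < 1 / 16)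
    (hα₀' : α₀ < α₀') (hα₁' : α₁ < α₁') (hγ₀' : γ₀ < γ₀') :
    ∃ δ : ℝ, 0 < δ ∧ ∀ {Φ : FieldPair P i 𝔸ˣ 𝔸}, SatisfiesI_III 𝓜 F c α₀ α₁ γ₀ Φ →
      ∀ {w : Site P i → 𝔸ˣ}, (∀ x, w x ∈ 𝓜.G) → ∀ {E : Site P i → 𝔸}, (∀ x, E x ∈ 𝓜.gc) →
        (∀ x, expI c.ξ (E x) ∈ 𝓜.Gc) → (∀ x, ∀ X ∈ 𝓜.gc, (expI c.ξ (E x) : 𝔸) * X * ↑(expI c.ξ (E x))⁻¹ ∈ 𝓜.gc) →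
          (∀ x, ‖E x‖ ≤ δ) → (∀ x μ, ‖nabla c.ξ Φ.U μ E x‖ ≤ δ) →
            SatisfiesI_III 𝓜 F c α₀' α₁' γ₀' (act (w * fun x => expI c.ξ (E x)) Φ) := by
  set K := 7 + 12 * α₁ + 3 * c.ξ * α₀ with hK
  have hK0 : 0 < K := by positivity
  obtain ⟨δ, hδ0, hδ1, hδ2, hδ3, hδ4⟩ : ∃ δ : ℝ, 0 < δ ∧ c.ξ * (α₁ + 2 * δ) ≤ 1 / 16 ∧
      4 * c.ξ * δ * α₀ ≤ α₀' - α₀ ∧ 4 * c.ξ * δ * γ₀ ≤ γ₀' - γ₀ ∧ K * δ ≤ α₁' - α₁ := by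
    set d₁ := (1 / 16 - c.ξ * α₁) / (2 * c.ξ) with hd₁
    set d₂ := (α₀' - α₀) / (4 * c.ξ * α₀ + 1) with hd₂
    set d₃ := (γ₀' - γ₀) / (4 * c.ξ * γ₀ + 1) with hd₃
    set d₄ := (α₁' - α₁) / K with hd₄
    have hd₁0 : 0 < d₁ := by rw [hd₁]; exact div_pos (by linarith) (by positivity)
    have hd₂0 : 0 < d₂ := by rw [hd₂]; exact div_pos (by linarith) (by positivity)
    have hd₃0 : 0 < d₃ := by rw [hd₃]; exact div_pos (by linarith) (by positivity)
    have hd₄0 : 0 < d₄ := by rw [hd₄]; exact div_pos (by linarith) hK0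
    refine ⟨min (min d₁ d₂) (min d₃ d₄), lt_min (lt_min hd₁0 hd₂0) (lt_min hd₃0 hd₄0), ?_, ?_, ?_, ?_⟩
    · have hle : min (min d₁ d₂) (min d₃ d₄) ≤ d₁ := (min_le_left _ _).trans (min_le_left _ _)
      have e : c.ξ * (α₁ + 2 * d₁) = 1 / 16 := by rw [hd₁]; field_simp; ring
      nlinarith [hξ.le]
    · have hle : min (min d₁ d₂) (min d₃ d₄) ≤ d₂ := (min_le_left _ _).trans (min_le_right _ _)
      have e : d₂ * (4 * c.ξ * α₀ + 1) = α₀' - α₀ := by rw [hd₂]; field_simp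
      have h0 : 0 ≤ min (min d₁ d₂) (min d₃ d₄) := (lt_min (lt_min hd₁0 hd₂0) (lt_min hd₃0 hd₄0)).le
      nlinarith [mul_le_mul_of_nonneg_right hle (by positivity : (0 : ℝ) ≤ 4 * c.ξ * α₀ + 1)]
    · have hle : min (min d₁ d₂) (min d₃ d₄) ≤ d₃ := (min_le_right _ _).trans (min_le_left _ _)
      have e : d₃ * (4 * c.ξ * γ₀ + 1) = γ₀' - γ₀ := by rw [hd₃]; field_simp
      have h0 : 0 ≤ min (min d₁ d₂) (min d₃ d₄) := (lt_min (lt_min hd₁0 hd₂0) (lt_min hd₃0 hd₄0)).le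
      nlinarith [mul_le_mul_of_nonneg_right hle (by positivity : (0 : ℝ) ≤ 4 * c.ξ * γ₀ + 1)]
    · have hle : min (min d₁ d₂) (min d₃ d₄) ≤ d₄ := (min_le_right _ _).trans (min_le_right _ _)
      have e : K * d₄ = α₁' - α₁ := by rw [hd₄]; field_simp
      nlinarith [mul_le_mul_of_nonneg_left hle hK0.le]
  refine ⟨δ, hδ0, fun h w hw E hEgc heGc hgcE hE0 hE1 => ?_⟩
  have h2ξδ : 2 * (c.ξ * δ) ≤ 1 := by nlinarith
  have hexp : Real.exp (2 * (c.ξ * δ)) ≤ 1 + 4 * c.ξ * δ := by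
    have h := Real.abs_exp_sub_one_sub_id_le (x := 2 * (c.ξ * δ)) (by rw [abs_of_nonneg (by positivity)]; exact h2ξδ)
    have h' := (abs_le.mp h).2
    have hx0 : 0 ≤ 2 * (c.ξ * δ) := by positivity
    have hx2 : (2 * (c.ξ * δ)) ^ 2 ≤ 2 * (c.ξ * δ) := by rw [sq]; exact mul_le_of_le_one_right hx0 h2ξδ
    linarith
  refine satisfiesI_III_act_near_step hG1 hGc hgc hgcN hXb hXp hξ hcB hα₀ hα₁ hδ0.le hδ1 ?_ ?_ ?_ h hw hEgc heGc hgcE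
    hE0 hE1
  · nlinarith [mul_le_mul_of_nonneg_right hexp hα₀]
  · nlinarith [mul_le_mul_of_nonneg_right hexp hγ₀]
  · rw [hK] at hδ4; nlinarith

end

end Literature.MathematicalPhysics.QuantumFieldTheory.Balaban1983to89.B12Spaces329NearStep
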